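import Literature.Computability.QuantumComplexity.ForrelationMemFields
import Literature.Computability.QuantumComplexity.SimonFourier
import Literature.Computability.Complexity.FoldBricks
import Literature.Computability.Complexity.KannanLanguage
import HarnessLib

/-!
# Simon's algorithm inside a phase-query family, I: the phase machine as string functions

First file of the quantum half of the discharge of
`Literature.Computability.Complexity.fortnowGrochow_Ker_eq_PEq_UP_subset_BQP` (Fortnow–Grochow 2011,
Thm. 4.3: `Ker = PEq ⟹ UP ⊆ BQP`; printed proof: "finding `w_a` or determining that there is no such
string is exactly Daniel Simon's problem, which is in BQP"). Simon's algorithm for a WHITE-BOX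
function `y ↦ F ⟨a, y⟩` (`F ∈ FP`) is run as an instance of the tree's uniform phase-query family
(`PhaseQuery*.lean`, the `1`-fold Forrelation circuit `H^{⊗W} U_G H^{⊗W} |0^W⟩`; its output law is
`PhaseQueryKernel.lean`, its Fourier sums `SimonBlockFourier.lean`): the register of `W = m (Q + r)`
active wires holds `m` blocks `(y_i, z_i) ∈ {0,1}^Q × {0,1}^r` and the phase is the additive
`G(a, u) = ⊕_i z_i · ĝ_a(y_i)` with `ĝ_a(y) = codeR r (F ⟨a, y⟩)` — `m` parallel runs of Simon's
Fourier-twice in phase-kickback form (Simon 1997, §3.1; Nielsen–Chuang 2010, §6.1.1). This file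
writes the phase predicate as a polynomial-time string function in the brick algebra
(`BrickAlgebra.lean`, `FoldBricks.lean`), with total semantics:

* `andStrFn` (bitwise `and`, a clipped concatenation fold as `xorStrFn` of `Learning/GLStageFP.lean`),
  `evenIpFn ⟨z, v⟩ = [Even #{p : z_p ∧ v_p}]` (`evenIpFn_ofFn`: the `EvenOverlap` of `SimonFourier.lean`);
* the input code `xcode a Q r m W = ⟨a, ⟨1^Q, ⟨1^r, ⟨1^m, 0^W⟩⟩⟩⟩` and the injective value code
  `codeR r w = (w 1 0^r)↾r` (`codeR_injective` on words shorter than `r`);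
* the loop body `bodyF F` on records `⟨x, ⟨cnt, ⟨rest, [b]⟩⟩⟩` (cut the next block `y z` off `rest`,
  `b := b ⊕ ¬Even(z · codeR r (F ⟨a, y⟩))`), its value `bodyF_rec`, its growth `length_bodyF_le`,
  the counted loop `loopF` (`loopFn_mem_FP`) and its model `gLoop`/`gLoop_snd`;
* **`GphaseS F`** — the mode-`P` answer on `⟨x, ⟨u, 1^j 0^{L-j}⟩⟩`: `[]` iff `j = 1` and the phase
  bit `Gbit F a Q r m u` (the xor of the block bits `stepBit`) is set (`GphaseS_eq_nil_iff`), with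
  **`GphaseS_mem_FP`**.

## References

* L. Fortnow, J. A. Grochow, *Complexity classes of equivalence problems revisited*, Inform. and
  Comput. 209 (2011) 748–763 = arXiv:0907.4775, Thm. 4.3 and its proof [FortnowGrochow2011].
* D. R. Simon, *On the power of quantum computation*, SIAM J. Comput. 26 (1997) 1474–1483, §3.1
  [Simon1997].
* S. Aaronson, A. Ambainis, *Forrelation*, SIAM J. Comput. 47 (2018), §3.2 (Fig. 2) and §6 (p. 26)
  [AaronsonAmbainis2018].
* M. A. Nielsen, I. L. Chuang, *Quantum Computation and Quantum Information*, CUP 2010, §6.1.1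
  [NielsenChuang2010].
* S. Arora, B. Barak, *Computational Complexity: A Modern Approach*, CUP 2009, §1.3 [AroraBarak2009].
-/

noncomputable section

namespace Literature.Computability.QuantumComplexity

open _root_.Computability Polynomial Complexity Complexity.Brick Plumb Finset

namespace SimonSampler

/-! ### Bitwise `and` of two strings and the parity of the overlap -/

/-- The piece of the `and` fold on `⟨⟨a, b⟩, 1ᵖ⟩`: `[a_p ∧ b_p]`. [folklore] -/
def andPiece : List Bool → List Bool :=
  andFn (HashBricks.headBitFn ∘ bitAtFn ∘ fanoutFn sndF (fstF ∘ fstF))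
    (HashBricks.headBitFn ∘ bitAtFn ∘ fanoutFn sndF (sndF ∘ fstF))

/-- `andPiece ∈ FP`. [folklore] -/
theorem andPiece_mem_FP : andPiece ∈ FP :=
  andFn_mem_FP
    (comp_mem_FP HashBricks.headBitFn_mem_FP (comp_mem_FP bitAtFn_mem_FP
      (fanoutFn_mem_FP sndF_mem_FP (comp_mem_FP fstF_mem_FP fstF_mem_FP))))
    (comp_mem_FP HashBricks.headBitFn_mem_FP (comp_mem_FP bitAtFn_mem_FP
      (fanoutFn_mem_FP sndF_mem_FP (comp_mem_FP sndF_mem_FP fstF_mem_FP))))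

/-- Value of `andPiece`. [folklore] -/
theorem andPiece_apply (w : List Bool) (p : ℕ) :
    andPiece (boolPair w (ones p)) = [((fstF w).drop p).headD false && ((sndF w).drop p).headD false] := by
  rw [andPiece, andFn_apply (b := ((fstF w).drop p).headD false) (b' := ((sndF w).drop p).headD false)]
  · simp only [Function.comp_apply, fanoutFn_apply, sndF_boolPair, fstF_boolPair, bitAtFn_boolPair,
      HashBricks.headBitFn_apply, List.length_replicate, ones]
    cases (fstF w).drop p <;> simp
  · simp only [Function.comp_apply, fanoutFn_apply, sndF_boolPair, fstF_boolPair, bitAtFn_boolPair,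
      HashBricks.headBitFn_apply, List.length_replicate, ones]
    cases (sndF w).drop p <;> simp

/-- `andPiece` is one-bit. [folklore] -/
theorem oneBit_andPiece : OneBit andPiece :=
  oneBit_andFn (HashBricks.oneBit_headBitFn.comp _) (HashBricks.oneBit_headBitFn.comp _)

/-- **Bitwise `and`** `⟨a, b⟩ ↦ (a_p ∧ b_p)_{p < |a|}`. [folklore] -/
def andStrFn : List Bool → List Bool :=
  sndPow 2 ∘ foldLoop appF (clipF 1 andPiece) X ∘
    fanoutFn id (fanoutFn (lenBinF ∘ fstF) (fun _ => boolPair [] []))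

/-- `andStrFn ∈ FP`. [folklore] -/
theorem andStrFn_mem_FP : andStrFn ∈ FP :=
  comp_mem_FP (sndPow_mem_FP 2) (comp_mem_FP
    (foldLoop_clipF_mem_FP 1 appF_mem_FP length_appF_le andPiece_mem_FP X)
    (fanoutFn_mem_FP (PolyTimeComputable.id _)
      (fanoutFn_mem_FP (comp_mem_FP lenBinF_mem_FP fstF_mem_FP) (const_mem_FP _))))

/-- A concatenation of singletons is an `ofFn`. [folklore] -/
theorem ccat_singleton_eq_ofFn (g : ℕ → Bool) : ∀ n : ℕ, ccat (fun τ => [g τ]) n = List.ofFn fun τ : Fin n => g τ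
  | 0 => by simp
  | n + 1 => by rw [ccat_succ, ccat_singleton_eq_ofFn g n, List.ofFn_succ']; simp

/-- Value of `andStrFn` on every input. [folklore] -/
theorem andStrFn_apply (w : List Bool) :
    andStrFn w = ccat (fun p => [((fstF w).drop p).headD false && ((sndF w).drop p).headD false]) (fstF w).length := by
  have hn : (fstF w).length ≤ X.eval w.length := by
    rw [eval_X]; have := length_fstF_sndF_le w; omega
  rw [andStrFn, Function.comp_apply, Function.comp_apply, fanoutFn_apply, fanoutFn_apply, id,
    Function.comp_apply, lenBinF_apply,
    show (boolPair ([] : List Bool) []) = boolPair (ones 0) ([] : List Bool) by rfl,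
    foldLoop_apply _ _ hn, foldAcc_clipF (fun j _ _ => by rw [(oneBit_andPiece).length_eq]; omega), foldAcc_appF]
  simp [sndPow, andPiece_apply]

/-- Reading position `p` of an `ofFn`. [folklore] -/
theorem headD_drop_ofFn {m : ℕ} (a : Fin m → Bool) {p : ℕ} (hp : p < m) : ((List.ofFn a).drop p).headD false = a ⟨p, hp⟩ := by
  rw [List.drop_eq_getElem_cons (by simpa using hp)]
  simp

/-- Value of `andStrFn` on genuine vectors. [folklore] -/
theorem andStrFn_ofFn {m : ℕ} (a b : Fin m → Bool) :
    andStrFn (boolPair (List.ofFn a) (List.ofFn b)) = List.ofFn fun p => a p && b p := by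
  rw [andStrFn_apply, fstF_boolPair, sndF_boolPair, List.length_ofFn,
    ccat_congr (g' := fun p => [if h : p < m then a ⟨p, h⟩ && b ⟨p, h⟩ else false])
    (fun p hp => by rw [headD_drop_ofFn a hp, headD_drop_ofFn b hp, dif_pos hp]), ccat_singleton_eq_ofFn]
  exact congrArg List.ofFn (funext fun p => by rw [dif_pos p.isLt])

/-- Counting a value in an `ofFn`. [folklore] -/
theorem count_ofFn {m : ℕ} (w : Fin m → Bool) (b : Bool) : (List.ofFn w).count b = (univ.filter fun i => w i = b).card := by
  rw [List.ofFn_eq_map, List.count, List.countP_map, List.countP_eq_length_filter]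
  rw [Fin.univ_def, Finset.card_def, Finset.filter_val]
  simp [Function.comp_def, Multiset.filter_coe, beq_eq_decide]

/-- **The parity of the overlap**: `⟨a, b⟩ ↦ [Even #{p : a_p ∧ b_p}]` (`= [(-1)^{a·b} = 1]`). [cite: Simon1997, §3.1] -/
def evenIpFn : List Bool → List Bool := Brick.parityFn ∘ HashBricks.popCountFn ∘ andStrFn

/-- `evenIpFn ∈ FP`. [folklore] -/
theorem evenIpFn_mem_FP : evenIpFn ∈ FP := comp_mem_FP Brick.parityFn_mem_FP (comp_mem_FP HashBricks.popCountFn_mem_FP andStrFn_mem_FP)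

/-- `evenIpFn` is one-bit. [folklore] -/
theorem oneBit_evenIpFn : OneBit evenIpFn := fun _ => ⟨_, rfl⟩

/-- **Value of `evenIpFn` on genuine vectors**: the evenness of the overlap (`Simon.EvenOverlap`). [cite: Simon1997, §3.1] -/
theorem evenIpFn_ofFn {m : ℕ} (a b : Fin m → Bool) :
    evenIpFn (boolPair (List.ofFn a) (List.ofFn b)) = [decide (Simon.EvenOverlap a b)] := by
  rw [evenIpFn, Function.comp_apply, Function.comp_apply, andStrFn_ofFn, HashBricks.popCountFn_apply, Brick.parityFn,
    bitsToNat_encodeNat]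
  unfold Simon.EvenOverlap
  rw [count_ofFn]
  congr 1

/-! ### The input code and the injective value code -/

/-- **The padded input** handed to the quantum sampler: the instance `a`, the block parameters
`Q`, `r`, the number of samples `m` in unary, and `W` zeros (so that the input is at least as long as
the `W = m (Q + r)` active query wires). [cite: FortnowGrochow2011, Thm. 4.3 (proof)] -/
def xcode (a : List Bool) (Q r m W : ℕ) : List Bool :=
  boolPair a (boolPair (ones Q) (boolPair (ones r) (boolPair (ones m) (List.replicate W false))))

/-- **The value code**: `w` padded by `1 0 0 …` and cut to length `r`; injective on the words of
length `< r`. [folklore] -/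
def codeR (r : ℕ) (w : List Bool) : List Bool := (w ++ true :: List.replicate r false).take r

/-- The value code has length `r`. [folklore] -/
@[simp] theorem length_codeR (r : ℕ) (w : List Bool) : (codeR r w).length = r := by
  simp [codeR]; omega

/-- The value code of a short word. [folklore] -/
theorem codeR_eq {r : ℕ} {w : List Bool} (hw : w.length < r) : codeR r w = w ++ true :: List.replicate (r - w.length - 1) false := by
  unfold codeR
  rw [List.take_append, List.take_of_length_le (le_of_lt hw),
    show r - w.length = (r - w.length - 1) + 1 by omega, List.take_succ_cons, List.take_replicate, Nat.min_eq_left (by omega),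
    Nat.add_sub_cancel]

/-- Dropping the leading zeros stops at the marker. [folklore] -/
theorem dropWhile_replicate_false_append (l : List Bool) : ∀ n : ℕ,
    (List.replicate n false ++ true :: l).dropWhile (fun b => b == false) = true :: l
  | 0 => by simp
  | n + 1 => by rw [List.replicate_succ, List.cons_append, List.dropWhile_cons_of_pos (by rfl)]; exact dropWhile_replicate_false_append l n

/-- **The value code is injective on short words.** [folklore] -/
theorem codeR_injective {r : ℕ} {w w' : List Bool} (hw : w.length < r) (hw' : w'.length < r) (h : codeR r w = codeR r w') :
    w = w' := by
  rw [codeR_eq hw, codeR_eq hw'] at h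
  have h' := congrArg (fun l : List Bool => (l.reverse.dropWhile fun b => b == false).tail.reverse) h
  simp only [List.reverse_append, List.reverse_cons, List.reverse_replicate, List.append_assoc, List.singleton_append,
    dropWhile_replicate_false_append, List.tail_cons, List.reverse_reverse] at h'
  exact h'

/-! ### One round of the phase loop -/

section Body

/-- The instance `a` (record `⟨x, ⟨cnt, ⟨rest, pb⟩⟩⟩`, `x = xcode a Q r m W`). [folklore] -/
def AF : List Bool → List Bool := fstF ∘ fstF
/-- `1^Q`. [folklore] -/
def QUF : List Bool → List Bool := nthF 1 ∘ fstF
/-- `1^r`. [folklore] -/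
def RUF : List Bool → List Bool := nthF 2 ∘ fstF
/-- `1^{Q+r}`. [folklore] -/
def BUF : List Bool → List Bool := fun z => QUF z ++ RUF z
/-- The unread part of the register. [folklore] -/
def RESTF : List Bool → List Bool := nthF 2
/-- The parity accumulated so far (one bit). [folklore] -/
def PBF : List Bool → List Bool := HashBricks.headBitFn ∘ sndPow 2
/-- The current block (the next `Q + r` register bits). [folklore] -/
def BLKF : List Bool → List Bool := takeFn ∘ fanoutFn BUF RESTF
/-- Its query part `y` (first `Q` bits). [folklore] -/
def YF : List Bool → List Bool := takeFn ∘ fanoutFn QUF BLKF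
/-- Its value part `z` (last `r` bits). [folklore] -/
def ZF : List Bool → List Bool := dropFn ∘ fanoutFn QUF BLKF
/-- The value `F ⟨a, y⟩`. [cite: FortnowGrochow2011, Thm. 4.3 (proof: `f_a(x) = f(a, x)`)] -/
def FVF (F : List Bool → List Bool) : List Bool → List Bool := F ∘ fanoutFn AF YF
/-- The padding `1 0^r`. [folklore] -/
def PADF : List Bool → List Bool := List.cons true ∘ Kannan.zerosFn ∘ RUF
/-- The value code `codeR r (F ⟨a, y⟩)`. [folklore] -/
def CODEF (F : List Bool → List Bool) : List Bool → List Bool := takeFn ∘ fanoutFn RUF (fun z => FVF F z ++ PADF z)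
/-- The parity bit of the overlap `z · codeR r (F ⟨a, y⟩)` (as evenness). [cite: Simon1997, §3.1] -/
def IPEF (F : List Bool → List Bool) : List Bool → List Bool := evenIpFn ∘ fanoutFn ZF (CODEF F)
/-- The new accumulated parity: `pb ⊕ ¬even`. [folklore] -/
def NEWPBF (F : List Bool → List Bool) : List Bool → List Bool := HashBricks.xorFn PBF (notFn (IPEF F))
/-- **The loop body**: consume one block, update the parity. [cite: Simon1997, §3.1] -/
def bodyF (F : List Bool → List Bool) : List Bool → List Bool := fanoutFn (dropFn ∘ fanoutFn BUF RESTF) (NEWPBF F)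

/-- `AF ∈ FP`. [folklore] -/
theorem AF_mem_FP : AF ∈ FP := comp_mem_FP fstF_mem_FP fstF_mem_FP
/-- `QUF ∈ FP`. [folklore] -/
theorem QUF_mem_FP : QUF ∈ FP := comp_mem_FP (nthF_mem_FP 1) fstF_mem_FP
/-- `RUF ∈ FP`. [folklore] -/
theorem RUF_mem_FP : RUF ∈ FP := comp_mem_FP (nthF_mem_FP 2) fstF_mem_FP
/-- `BUF ∈ FP`. [folklore] -/
theorem BUF_mem_FP : BUF ∈ FP := append_mem_FP QUF_mem_FP RUF_mem_FP
/-- `RESTF ∈ FP`. [folklore] -/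
theorem RESTF_mem_FP : RESTF ∈ FP := nthF_mem_FP 2
/-- `PBF ∈ FP`. [folklore] -/
theorem PBF_mem_FP : PBF ∈ FP := comp_mem_FP HashBricks.headBitFn_mem_FP (sndPow_mem_FP 2)
/-- `BLKF ∈ FP`. [folklore] -/
theorem BLKF_mem_FP : BLKF ∈ FP := comp_mem_FP takeFn_mem_FP (fanoutFn_mem_FP BUF_mem_FP RESTF_mem_FP)
/-- `YF ∈ FP`. [folklore] -/
theorem YF_mem_FP : YF ∈ FP := comp_mem_FP takeFn_mem_FP (fanoutFn_mem_FP QUF_mem_FP BLKF_mem_FP)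
/-- `ZF ∈ FP`. [folklore] -/
theorem ZF_mem_FP : ZF ∈ FP := comp_mem_FP dropFn_mem_FP (fanoutFn_mem_FP QUF_mem_FP BLKF_mem_FP)

variable {F : List Bool → List Bool}

/-- `CODEF F ∈ FP` for `F ∈ FP`. [folklore] -/
theorem CODEF_mem_FP (hF : F ∈ FP) : CODEF F ∈ FP := by
  have hV : FVF F ∈ FP := comp_mem_FP hF (fanoutFn_mem_FP AF_mem_FP YF_mem_FP)
  have hP : PADF ∈ FP := comp_mem_FP (cons_mem_FP true) (comp_mem_FP Kannan.zerosFn_mem_FP RUF_mem_FP)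
  exact comp_mem_FP takeFn_mem_FP (fanoutFn_mem_FP RUF_mem_FP (append_mem_FP hV hP))

/-- `IPEF F ∈ FP` for `F ∈ FP`. [folklore] -/
theorem IPEF_mem_FP (hF : F ∈ FP) : IPEF F ∈ FP := comp_mem_FP evenIpFn_mem_FP (fanoutFn_mem_FP ZF_mem_FP (CODEF_mem_FP hF))

/-- `IPEF F` is one-bit. [folklore] -/
theorem oneBit_IPEF : OneBit (IPEF F) := oneBit_evenIpFn.comp _

/-- `PBF` is one-bit. [folklore] -/
theorem oneBit_PBF : OneBit PBF := HashBricks.oneBit_headBitFn.comp _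

/-- `NEWPBF F ∈ FP` for `F ∈ FP`. [folklore] -/
theorem NEWPBF_mem_FP (hF : F ∈ FP) : NEWPBF F ∈ FP := HashBricks.xorFn_mem_FP PBF_mem_FP (notFn_mem_FP (IPEF_mem_FP hF))

/-- `NEWPBF F` is one-bit. [folklore] -/
theorem oneBit_NEWPBF : OneBit (NEWPBF F) := HashBricks.oneBit_xorFn oneBit_PBF (oneBit_notFn oneBit_IPEF)

/-- **`bodyF F ∈ FP`** for `F ∈ FP`. [cite: AroraBarak2009, §1.3] -/
theorem bodyF_mem_FP (hF : F ∈ FP) : bodyF F ∈ FP :=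
  fanoutFn_mem_FP (comp_mem_FP dropFn_mem_FP (fanoutFn_mem_FP BUF_mem_FP RESTF_mem_FP)) (NEWPBF_mem_FP hF)

/-- **Growth of the body**: it shortens the state, on every input. [folklore] -/
theorem length_bodyF_le (z : List Bool) : (bodyF F z).length ≤ (sndPow 1 z).length + 3 * ((fstF z).length + 1) := by
  obtain ⟨b, hb⟩ := oneBit_NEWPBF (F := F) z
  rw [bodyF, fanoutFn_apply, length_boolPair, hb, Function.comp_apply, fanoutFn_apply, dropFn_boolPair, List.length_drop,
    List.length_singleton]
  have h1 : (RESTF z).length ≤ (sndPow 1 z).length / 2 := by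
    show (fstF (sndPow 1 z)).length ≤ (sndPow 1 z).length / 2
    have := length_fstF_sndF_le (sndPow 1 z)
    omega
  omega

/-! ### Values on genuine records -/

/-- The genuine record of the loop: the padded input, the countdown, the unread register bits and the
parity. [folklore] -/
def rec (a : List Bool) (Q r m W : ℕ) (cnt rest : List Bool) (b : Bool) : List Bool :=
  boolPair (xcode a Q r m W) (boolPair cnt (boolPair rest [b]))

variable (a : List Bool) (Q r m W : ℕ) (cnt rest : List Bool) (b : Bool)

/-- `AF` on a genuine record. [folklore] -/
theorem AF_rec : AF (rec a Q r m W cnt rest b) = a := by simp [AF, rec, xcode]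
/-- `QUF` on a genuine record. [folklore] -/
theorem QUF_rec : QUF (rec a Q r m W cnt rest b) = ones Q := by simp [QUF, rec, xcode, nthF]
/-- `RUF` on a genuine record. [folklore] -/
theorem RUF_rec : RUF (rec a Q r m W cnt rest b) = ones r := by simp [RUF, rec, xcode, nthF]
/-- `BUF` on a genuine record. [folklore] -/
theorem BUF_rec : BUF (rec a Q r m W cnt rest b) = ones (Q + r) := by simp [BUF, QUF_rec, RUF_rec, ones]
/-- `RESTF` on a genuine record. [folklore] -/
theorem RESTF_rec : RESTF (rec a Q r m W cnt rest b) = rest := by simp [RESTF, rec, nthF]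
/-- `PBF` on a genuine record. [folklore] -/
theorem PBF_rec : PBF (rec a Q r m W cnt rest b) = [b] := by simp [PBF, rec, sndPow]
/-- `BLKF` on a genuine record. [folklore] -/
theorem BLKF_rec : BLKF (rec a Q r m W cnt rest b) = rest.take (Q + r) := by
  rw [BLKF, Function.comp_apply, fanoutFn_apply, BUF_rec, RESTF_rec, takeFn_boolPair]; simp [ones]
/-- `YF` on a genuine record. [folklore] -/
theorem YF_rec : YF (rec a Q r m W cnt rest b) = (rest.take (Q + r)).take Q := by
  rw [YF, Function.comp_apply, fanoutFn_apply, QUF_rec, BLKF_rec, takeFn_boolPair]; simp [ones]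
/-- `ZF` on a genuine record. [folklore] -/
theorem ZF_rec : ZF (rec a Q r m W cnt rest b) = (rest.take (Q + r)).drop Q := by
  rw [ZF, Function.comp_apply, fanoutFn_apply, QUF_rec, BLKF_rec, dropFn_boolPair]; simp [ones]
/-- `CODEF` on a genuine record. [folklore] -/
theorem CODEF_rec : CODEF F (rec a Q r m W cnt rest b) = codeR r (F (boolPair a ((rest.take (Q + r)).take Q))) := by
  rw [CODEF, Function.comp_apply, fanoutFn_apply, RUF_rec, takeFn_boolPair]
  simp only [FVF, PADF, Function.comp_apply, fanoutFn_apply, AF_rec, YF_rec, RUF_rec, Kannan.zerosFn_apply]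
  simp [ones, codeR]

/-- **The parity bit of the overlap** read off the brick (`evenIpFn` is one-bit). [folklore] -/
def ipEven (zz v : List Bool) : Bool := (evenIpFn (boolPair zz v)).headD false

omit a Q r m W cnt rest b in
/-- `evenIpFn` returns `[ipEven]`. [folklore] -/
theorem evenIpFn_eq (zz v : List Bool) : evenIpFn (boolPair zz v) = [ipEven zz v] := by
  obtain ⟨b, hb⟩ := oneBit_evenIpFn (boolPair zz v); rw [ipEven, hb]; rfl

/-- **The bit contributed by one block**: the oddness of `z · codeR r (F ⟨a, y⟩)`. [cite: Simon1997, §3.1] -/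
def stepBit (F : List Bool → List Bool) (a : List Bool) (Q r : ℕ) (blk : List Bool) : Bool :=
  !ipEven (blk.drop Q) (codeR r (F (boolPair a (blk.take Q))))

/-- `IPEF` on a genuine record. [folklore] -/
theorem IPEF_rec : IPEF F (rec a Q r m W cnt rest b) = [!stepBit F a Q r (rest.take (Q + r))] := by
  rw [IPEF, Function.comp_apply, fanoutFn_apply, ZF_rec, CODEF_rec, evenIpFn_eq, stepBit, Bool.not_not]

/-- **The value of the body on a genuine record.** [folklore] -/
theorem bodyF_rec : bodyF F (rec a Q r m W cnt rest b) = boolPair (rest.drop (Q + r)) [xor b (stepBit F a Q r (rest.take (Q + r)))] := by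
  rw [bodyF, fanoutFn_apply, Function.comp_apply, fanoutFn_apply, BUF_rec, RESTF_rec, dropFn_boolPair]
  simp only [ones, List.length_replicate]
  congr 1
  rw [NEWPBF, HashBricks.xorFn_apply (PBF_rec a Q r m W cnt rest b) (notFn_apply (IPEF_rec a Q r m W cnt rest b)), Bool.not_not]

end Body

/-! ### The phase loop: model and value -/

section Loop

variable {F : List Bool → List Bool}

/-- **The model of the phase loop**: from `k` blocks to go, the unread bits `rest` and parity `b`,
consume the blocks one by one. [cite: Simon1997, §3.1] -/
def gLoop (F : List Bool → List Bool) (a : List Bool) (Q r : ℕ) : ℕ → List Bool → Bool → List Bool × Bool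
  | 0, rest, b => (rest, b)
  | k + 1, rest, b => gLoop F a Q r k (rest.drop (Q + r)) (xor b (stepBit F a Q r (rest.take (Q + r))))

/-- **The loop runs the model.** [folklore] -/
theorem loopModel_bodyF (a : List Bool) (Q r m W : ℕ) : ∀ (k : ℕ) (rest : List Bool) (b : Bool),
    loopModel (bodyF F) (xcode a Q r m W) k (boolPair rest [b]) =
      boolPair (gLoop F a Q r k rest b).1 [(gLoop F a Q r k rest b).2]
  | 0, rest, b => rfl
  | k + 1, rest, b => by
    rw [loopModel, show boolPair (xcode a Q r m W) (boolPair (encodeNat (k + 1)) (boolPair rest [b])) =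
      rec a Q r m W (encodeNat (k + 1)) rest b from rfl, bodyF_rec, loopModel_bodyF a Q r m W k]
    rfl

/-- **The accumulated bit in closed form**: the parity so far xored with the bits of the `k` blocks
`rest[i(Q+r), (i+1)(Q+r))`, `i < k`. [cite: Simon1997, §3.1] -/
theorem gLoop_snd (a : List Bool) (Q r : ℕ) : ∀ (k : ℕ) (rest : List Bool) (b : Bool),
    (gLoop F a Q r k rest b).2 = xor b ((List.range k).foldr (fun i acc => xor (stepBit F a Q r ((rest.drop (i * (Q + r))).take (Q + r))) acc) false)
  | 0, rest, b => by simp [gLoop]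
  | k + 1, rest, b => by
    rw [gLoop, gLoop_snd a Q r k, List.range_succ_eq_map, List.foldr_cons, List.foldr_map]
    simp only [Nat.zero_mul, List.drop_zero, List.drop_drop, Nat.succ_mul]
    simp only [Nat.add_comm (Q + r) _]
    cases b <;> cases stepBit F a Q r (List.take (Q + r) rest) <;> simp

/-- **The loop as a string function**: `X (|x|)` rounds of the body (enough: `m ≤ |x|`). [cite: AroraBarak2009, §1.3] -/
def loopF (F : List Bool → List Bool) : List Bool → List Bool := fun z => (loopStep (bodyF F))^[X.eval (fstF z).length] z

/-- `loopF F ∈ FP` for `F ∈ FP`. [cite: AroraBarak2009, §1.3 (bounded loops)] -/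
theorem loopF_mem_FP (hF : F ∈ FP) : loopF F ∈ FP := loopFn_mem_FP (bodyF_mem_FP hF) length_bodyF_le X

/-- The padded input is at least `m` long. [folklore] -/
theorem le_length_xcode (a : List Bool) (Q r m W : ℕ) : m ≤ (xcode a Q r m W).length := by
  simp [xcode, length_boolPair, ones]; omega

/-- **Value of the loop** started at countdown `m`, the whole register and parity `0`. [folklore] -/
theorem loopF_rec (a : List Bool) (Q r m W : ℕ) (u : List Bool) :
    loopF F (rec a Q r m W (encodeNat m) u false) = rec a Q r m W [] (gLoop F a Q r m u false).1 (gLoop F a Q r m u false).2 := by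
  rw [loopF, rec, fstF_boolPair, iterate_loopStep _ _ m _ _ (by rw [eval_X]; exact le_length_xcode a Q r m W), loopModel_bodyF]
  rfl

end Loop

/-! ### The phase function of the machine -/

section Phase

variable {F : List Bool → List Bool}

/-- The initial record `⟨x, ⟨bin m, ⟨u, [0]⟩⟩⟩` built from the mode-`P` input `⟨x, ⟨u, jv⟩⟩`. [folklore] -/
def mkF : List Bool → List Bool :=
  fanoutFn fstF (fanoutFn (lenBinF ∘ nthF 3 ∘ fstF) (fanoutFn (fstF ∘ sndF) (fun _ => [false])))

/-- `mkF ∈ FP`. [folklore] -/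
theorem mkF_mem_FP : mkF ∈ FP :=
  fanoutFn_mem_FP fstF_mem_FP (fanoutFn_mem_FP (comp_mem_FP lenBinF_mem_FP (comp_mem_FP (nthF_mem_FP 3) fstF_mem_FP))
    (fanoutFn_mem_FP (comp_mem_FP fstF_mem_FP sndF_mem_FP) (const_mem_FP _)))

/-- Value of `mkF` on a genuine input. [folklore] -/
theorem mkF_apply (a : List Bool) (Q r m W : ℕ) (u jv : List Bool) :
    mkF (boolPair (xcode a Q r m W) (boolPair u jv)) = rec a Q r m W (encodeNat m) u false := by
  simp [mkF, rec, xcode, nthF, ones]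

/-- **The phase bit** `G(x, u)` as a string function: the final parity of the loop. [cite: Simon1997, §3.1] -/
def GbitF (F : List Bool → List Bool) : List Bool → List Bool := PBF ∘ loopF F ∘ mkF

/-- `GbitF F ∈ FP` for `F ∈ FP`. [cite: AroraBarak2009, §1.3] -/
theorem GbitF_mem_FP (hF : F ∈ FP) : GbitF F ∈ FP := comp_mem_FP PBF_mem_FP (comp_mem_FP (loopF_mem_FP hF) mkF_mem_FP)

/-- `GbitF F` is one-bit. [folklore] -/
theorem oneBit_GbitF : OneBit (GbitF F) := oneBit_PBF.comp _

/-- **The semantic phase bit**: the xor of the block bits of the first `m` blocks of the register. [cite: Simon1997, §3.1] -/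
def Gbit (F : List Bool → List Bool) (a : List Bool) (Q r m : ℕ) (u : List Bool) : Bool :=
  (List.range m).foldr (fun i acc => xor (stepBit F a Q r ((u.drop (i * (Q + r))).take (Q + r))) acc) false

/-- **Value of `GbitF`** on a genuine input. [folklore] -/
theorem GbitF_apply (a : List Bool) (Q r m W : ℕ) (u jv : List Bool) :
    GbitF F (boolPair (xcode a Q r m W) (boolPair u jv)) = [Gbit F a Q r m u] := by
  rw [GbitF, Function.comp_apply, Function.comp_apply, mkF_apply, loopF_rec, PBF_rec, gLoop_snd, Bool.false_xor, Gbit]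

/-- The layer test `j = 1`: the layer register `1^j 0^{L-j}` starts with `1 0`. [folklore] -/
def J1F : List Bool → List Bool :=
  andFn (ForrMem.isSetF (take1Fn ∘ sndF ∘ sndF)) (notFn (ForrMem.isSetF (take1Fn ∘ List.tail ∘ sndF ∘ sndF)))

/-- `J1F ∈ FP`. [folklore] -/
theorem J1F_mem_FP : J1F ∈ FP :=
  andFn_mem_FP (ForrMem.isSetF_mem_FP (comp_mem_FP take1Fn_mem_FP (comp_mem_FP sndF_mem_FP sndF_mem_FP)))
    (notFn_mem_FP (ForrMem.isSetF_mem_FP (comp_mem_FP take1Fn_mem_FP (comp_mem_FP PRelSigma.tail_mem_FP (comp_mem_FP sndF_mem_FP sndF_mem_FP)))))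

/-- Value of `J1F` on a unary layer register of length `≥ 2`. [folklore] -/
theorem J1F_apply (x u : List Bool) {L : ℕ} (j : ℕ) (hL : 2 ≤ L) :
    J1F (boolPair x (boolPair u (PhaseQuery.junary L j))) = [decide (j = 1)] := by
  have e0 : (take1Fn ∘ sndF ∘ sndF) (boolPair x (boolPair u (PhaseQuery.junary L j))) = [decide (1 ≤ j)] := by
    simp only [Function.comp_apply, sndF_boolPair, take1Fn, PhaseQuery.junary]
    rcases j with _ | j
    · simp; rcases L with _ | L <;> simp [List.replicate_succ] at hL ⊢
    · simp [List.replicate_succ]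
  have e1 : (take1Fn ∘ List.tail ∘ sndF ∘ sndF) (boolPair x (boolPair u (PhaseQuery.junary L j))) = [decide (2 ≤ j)] := by
    simp only [Function.comp_apply, sndF_boolPair, take1Fn, PhaseQuery.junary]
    rcases j with _ | _ | j
    · rcases L with _ | _ | L <;> simp [List.replicate_succ] at hL ⊢
    · rcases L with _ | _ | L <;> simp [List.replicate_succ] at hL ⊢
    · simp [List.replicate_succ]
  have f0 : ForrMem.isSetF (take1Fn ∘ sndF ∘ sndF) (boolPair x (boolPair u (PhaseQuery.junary L j))) = [decide (1 ≤ j)] :=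
    ForrMem.isSetF_of_eq e0
  have f1 : ForrMem.isSetF (take1Fn ∘ List.tail ∘ sndF ∘ sndF) (boolPair x (boolPair u (PhaseQuery.junary L j))) = [decide (2 ≤ j)] :=
    ForrMem.isSetF_of_eq e1
  rw [J1F, andFn_apply f0 (notFn_apply f1)]
  congr 1
  by_cases h1 : j = 1
  · subst h1; simp
  · by_cases h2 : 1 ≤ j
    · simp [h1, h2]; omega
    · simp [h1, h2]

/-- **The mode-`P` answer of the Simon phase machine** on `⟨x, ⟨u, jv⟩⟩`: empty (phase `−1`) iff the
layer is `1` and the phase bit `G(x, u)` is set. [cite: Simon1997, §3.1] [cite: AaronsonAmbainis2018, §3.2 (Fig. 2, k = 1)] -/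
def GphaseS (F : List Bool → List Bool) : List Bool → List Bool :=
  iteFn (andFn J1F (ForrMem.isSetF (GbitF F))) (fun _ => []) (fun _ => [true])

/-- **`GphaseS F ∈ FP`** for `F ∈ FP`. [cite: AroraBarak2009, §1.3] -/
theorem GphaseS_mem_FP (hF : F ∈ FP) : GphaseS F ∈ FP :=
  iteFn_mem_FP (andFn_mem_FP J1F_mem_FP (ForrMem.isSetF_mem_FP (GbitF_mem_FP hF))) (const_mem_FP _) (const_mem_FP _)

/-- **Value of `GphaseS`** on a genuine input with a unary layer register: empty iff `j = 1` and
the phase bit is set. [cite: Simon1997, §3.1] -/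
theorem GphaseS_eq_nil_iff (a : List Bool) (Q r m W : ℕ) (u : List Bool) {L : ℕ} (j : ℕ) (hL : 2 ≤ L) :
    GphaseS F (boolPair (xcode a Q r m W) (boolPair u (PhaseQuery.junary L j))) = [] ↔ (j = 1 ∧ Gbit F a Q r m u = true) := by
  have hc : andFn J1F (ForrMem.isSetF (GbitF F)) (boolPair (xcode a Q r m W) (boolPair u (PhaseQuery.junary L j))) =
      [decide (j = 1) && Gbit F a Q r m u] :=
    andFn_apply (J1F_apply _ u j hL) (ForrMem.isSetF_of_eq (GbitF_apply a Q r m W u _))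
  rw [GphaseS, iteFn_apply hc]
  by_cases h : (decide (j = 1) && Gbit F a Q r m u) = true
  · rw [if_pos h]; simp only [Bool.and_eq_true, decide_eq_true_eq] at h; simp [h]
  · rw [if_neg h]; simp only [Bool.and_eq_true, decide_eq_true_eq, not_and] at h
    simp only [List.cons_ne_nil, false_iff, not_and]
    exact h

end Phase

end SimonSampler

end Literature.Computability.QuantumComplexity
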